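import Literature.NumberTheory.ModularForms.JacobiThetaGammaTwo
import Literature.NumberTheory.Automorphic.ModularLambdaCovering
import Literature.NumberTheory.Automorphic.WohlfahrtLevel
import Literature.NumberTheory.Automorphic.ModularLambdaQExpansion
import Mathlib.NumberTheory.ModularForms.Basic
import Mathlib.NumberTheory.ModularForms.QExpansion
import Mathlib.RingTheory.PowerSeries.Expand
import Mathlib.RingTheory.PowerSeries.Inverse
import HarnessLib

/-!
# From weight `2n` to weight `0`: the modular functions `F/θ₃^{4n}` of CDT's space `R_N`

Topic `Literature/NumberTheory/Automorphic`. Part of the formalization of F. Calegari,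
V. Dimitrov, Y. Tang, *The unbounded denominators conjecture* (arXiv:2109.09040v5), §3: CDT's
Proposition 15 bounds the `ℚ(λ)`-dimension of the space `R_N` of *modular functions* (weight `0`)
with rational Fourier coefficients, bounded denominators and cusp widths dividing `2N`; a modular
*form* `F ∈ M_{2n}(G)` with integral coefficients is turned into such a function by dividing by a
nonvanishing form of the same weight for `Γ(2)` with Fourier expansion in `1 + qℤ⟦q⟧`. We use
`Uⁿ`, `U = θ₃⁴ ∈ M₂(Γ(2))` (`Literature/NumberTheory/ModularForms/JacobiThetaGammaTwo.lean`):
`U → 1` at `i∞`, `U ≠ 0` on `ℍ`, `qExpansion 2 U = A⁴ ∈ 1 + qℤ⟦q⟧`.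

* `thetaU_slash_T_sq`, `thetaU_slash_S_inv`, `thetaU_slash_S_T_sq_S_inv`, `SL_slash_neg_one_of_even`,
  **`thetaU_slash_of_mem_Gamma_two`** (`U ∣₂ γ = U` for `γ ∈ Γ(2) = ±⟨T², ST²S⁻¹⟩`, via
  `ModularLambdaCovering.mem_closure_T_sq_or_neg_mem`), `thetaU_smul_of_mem_Gamma_two`;
* `def thetaQuot n F := F/Uⁿ`; `mdifferentiable_thetaQuot`; **`thetaQuot_smul_of_mem_Gamma_two`**
  (`(F/Uⁿ)(γτ) = ((F ∣_{2n} γ)/Uⁿ)(τ)`, `γ ∈ Γ(2)`); `tendsto_thetaQuot`; periods of `U`;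
* slashes of a modular form for `G ⊴ SL₂(ℤ)` of finite index: `denom_T_zpow`,
  `slash_slash_T_pow_wohlfahrtLevel` (`(F ∣ h) ∣ T^{N_G} = F ∣ h`), `slash_vadd_wohlfahrtLevel`,
  **`tendsto_slash_atImInfty`** (the value of `F ∣ₖ h` at `i∞` exists, every `h ∈ SL₂(ℤ)`;
  Mathlib's `bdd_at_infty_slash` + bare `q`-expansion API);
* for `F ∈ M_{2n}(G)`: **`thetaQuot_smul_of_mem`** (invariance under `G ∩ Γ(2)`),
  **`tendsto_thetaQuot_smul`** (cusp values `c(h) = (F ∣_{2n} h)(i∞)` for `h ∈ Γ(2)`),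
  `thetaQuot_vadd`/`periodic_thetaQuot` (period `2N_G`);
* `q`-expansions: **`qExpansion_natMul_eq_expand`** (`qExpansion (Mh) f = (qExpansion h f)(X^M)`,
  general), `exists_qExpansion_two_thetaU_eq_map`, `exists_qExpansion_thetaU_pow_eq_map`,
  `qExpansion_form_two_mul`, `qExpansion_thetaQuot_mul`, and
  **`exists_qExpansion_thetaQuot_eq_map`** — if `qExpansion N_G F ∈ ℤ⟦q⟧` then
  `qExpansion (2N_G) (F/Uⁿ) ∈ ℤ⟦w⟧`, `w = e^{πiτ/N_G}`.

Downstream (`ModularLambdaPullback.exists_ratSeries_and_pullback`, `ModularLambdaXExpansion`)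
these are exactly the hypotheses producing the rational `x`-expansion `x^*(F/Uⁿ) ∈ ℚ⟦x⟧`,
integral after `x ↦ x(t)`, and the holomorphic pullback along `φ : D → ℂ ∖ 16^{-1/N}μ_N` of
Theorem 3 (iii).

## References

* [CalegariDimitrovTang2025] F. Calegari, V. Dimitrov, Y. Tang, *The unbounded denominators
  conjecture*, J. Amer. Math. Soc. 38 (2025), arXiv:2109.09040 — §3, Proposition 15 and its proof
  (the space `R_N`; "if `f(q) ∈ ℤ⟦q^{1/N}⟧` then `x^*f ∈ ℤ[1/N]⟦x⟧`").
-/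

noncomputable section

open Complex Filter Topology UpperHalfPlane ModularGroup Matrix.SpecialLinearGroup Set Metric
  Function Literature.NumberTheory.ModularForms

open scoped MatrixGroups ModularForm Real Manifold

namespace Literature.NumberTheory.Automorphic

namespace ModularLambda

/-! ## `U = θ₃⁴` is a weight-`2` invariant of `Γ(2)` -/

/-- `U ∣₂ T² = U` (`U ∣ T = W`, `W ∣ T = U`). [folklore] -/
theorem thetaU_slash_T_sq : thetaU ∣[(2 : ℤ)] (T ^ 2) = thetaU := by
  rw [pow_two, SlashAction.slash_mul, thetaU_slash_T, thetaW_slash_T]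

/-- `U ∣₂ S⁻¹ = -U` (from `U ∣ S = -U`). [folklore] -/
theorem thetaU_slash_S_inv : thetaU ∣[(2 : ℤ)] S⁻¹ = -thetaU := by
  have h : (thetaU ∣[(2 : ℤ)] S) ∣[(2 : ℤ)] S⁻¹ = thetaU := by
    rw [← SlashAction.slash_mul, mul_inv_cancel, SlashAction.slash_one]
  rw [thetaU_slash_S, SlashAction.neg_slash, neg_eq_iff_eq_neg] at h
  exact h

/-- `U ∣₂ (S T² S⁻¹) = U`. [folklore] -/
theorem thetaU_slash_S_T_sq_S_inv : thetaU ∣[(2 : ℤ)] (S * T ^ 2 * S⁻¹) = thetaU := by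
  rw [SlashAction.slash_mul, SlashAction.slash_mul, thetaU_slash_S, SlashAction.neg_slash,
    thetaU_slash_T_sq, SlashAction.neg_slash, thetaU_slash_S_inv, neg_neg]

/-- A function of even weight is invariant under `-1 ∈ SL₂(ℤ)`. [folklore] -/
theorem SL_slash_neg_one_of_even (f : ℍ → ℂ) {k : ℤ} (hk : Even k) :
    f ∣[k] (-1 : SL(2, ℤ)) = f := by
  funext τ
  rw [ModularForm.SL_slash_apply]
  have hsmul : (-1 : SL(2, ℤ)) • τ = τ := by
    rw [ModularGroup.SL_neg_smul, one_smul]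
  have hden : denom (Matrix.SpecialLinearGroup.toGL ((Matrix.SpecialLinearGroup.map (Int.castRingHom ℝ))
      (-1 : SL(2, ℤ)))) τ = -1 := by
    simp [denom]
  rw [hsmul, hden, (Even.neg hk).neg_one_zpow, mul_one]

/-- `U ∣₂ (-1) = U`. [folklore] -/
theorem thetaU_slash_neg_one : thetaU ∣[(2 : ℤ)] (-1 : SL(2, ℤ)) = thetaU :=
  SL_slash_neg_one_of_even _ (by decide)

/-- **`U = θ₃⁴ ∈ M₂(Γ(2))`: `U ∣₂ γ = U` for every `γ ∈ Γ(2)`** (`Γ(2) = ±⟨T², ST²S⁻¹⟩`).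
[folklore] -/
theorem thetaU_slash_of_mem_Gamma_two {γ : SL(2, ℤ)} (hγ : γ ∈ CongruenceSubgroup.Gamma 2) :
    thetaU ∣[(2 : ℤ)] γ = thetaU := by
  -- the stabiliser of `U`
  let K : Subgroup SL(2, ℤ) :=
    { carrier := {γ | thetaU ∣[(2 : ℤ)] γ = thetaU}
      mul_mem' := fun {a b} ha hb ↦ by
        simp only [Set.mem_setOf_eq] at ha hb ⊢
        rw [SlashAction.slash_mul, ha, hb]
      one_mem' := by
        simp only [Set.mem_setOf_eq]
        exact SlashAction.slash_one _ _
      inv_mem' := fun {a} ha ↦ by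
        simp only [Set.mem_setOf_eq] at ha ⊢
        have h := SlashAction.slash_mul (2 : ℤ) a a⁻¹ thetaU
        rw [mul_inv_cancel, SlashAction.slash_one, ha] at h
        exact h.symm }
  have hcl : Subgroup.closure {T ^ 2, S * T ^ 2 * S⁻¹} ≤ K := by
    refine (Subgroup.closure_le K).mpr ?_
    rintro x (rfl | rfl)
    exacts [thetaU_slash_T_sq, thetaU_slash_S_T_sq_S_inv]
  have hneg : ∀ γ : SL(2, ℤ), -γ ∈ K → γ ∈ K := by
    intro γ h
    have h1 : γ = (-1 : SL(2, ℤ)) * -γ := by simp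
    show thetaU ∣[(2 : ℤ)] γ = thetaU
    rw [h1, SlashAction.slash_mul, thetaU_slash_neg_one]
    exact h
  rcases mem_closure_T_sq_or_neg_mem hγ with h | h
  · exact hcl h
  · exact hneg γ (hcl h)

/-- `U(γτ) = (cτ + d)² U(τ)` for `γ ∈ Γ(2)`. [folklore] -/
theorem thetaU_smul_of_mem_Gamma_two {γ : SL(2, ℤ)} (hγ : γ ∈ CongruenceSubgroup.Gamma 2) (τ : ℍ) :
    thetaU (γ • τ) =
      denom (Matrix.SpecialLinearGroup.toGL ((Matrix.SpecialLinearGroup.map (Int.castRingHom ℝ)) γ))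
        τ ^ (2 : ℤ) * thetaU τ := by
  have h := congrFun (thetaU_slash_of_mem_Gamma_two hγ) τ
  rw [ModularForm.SL_slash_apply] at h
  have hd := denom_ne_zero (Matrix.SpecialLinearGroup.toGL
    ((Matrix.SpecialLinearGroup.map (Int.castRingHom ℝ)) γ)) τ
  conv_rhs => rw [← h]
  rw [mul_comm (thetaU (γ • τ)), ← mul_assoc, ← zpow_add₀ hd]
  norm_num

/-! ## The weight-`0` quotient `F / Uⁿ` -/

/-- **The weight-zero quotient** `F/Uⁿ = F/θ₃^{4n}` of a function `F` (of weight `2n`) by the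
nonvanishing weight-`2` form `U = θ₃⁴` of `Γ(2)` — CDT pass from modular forms with integral
Fourier coefficients to the modular functions of `R_N` (`θ₃^{-4n} ∈ 1 + qℤ⟦q⟧`).
[cite: CalegariDimitrovTang2025, §3 Proposition 15 (the space `R_N` of modular functions)] -/
def thetaQuot (n : ℕ) (F : ℍ → ℂ) : ℍ → ℂ := fun τ ↦ F τ / thetaU τ ^ n

/-- Unfolding `thetaQuot`. [folklore] -/
theorem thetaQuot_apply (n : ℕ) (F : ℍ → ℂ) (τ : ℍ) : thetaQuot n F τ = F τ / thetaU τ ^ n := rfl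

/-- `F/Uⁿ` is holomorphic when `F` is. [folklore] -/
theorem mdifferentiable_thetaQuot (n : ℕ) {F : ℍ → ℂ} (hF : MDiff F) : MDiff (thetaQuot n F) := by
  refine UpperHalfPlane.mdifferentiable_iff.mpr ?_
  have hF' := UpperHalfPlane.mdifferentiable_iff.mp hF
  have hU' := UpperHalfPlane.mdifferentiable_iff.mp mdifferentiable_thetaU
  have heq : thetaQuot n F ∘ ofComplex = fun z ↦ (F ∘ ofComplex) z / ((thetaU ∘ ofComplex) z) ^ n := by
    funext z; rfl
  rw [heq]
  exact hF'.div (hU'.pow n) fun z _ ↦ pow_ne_zero _ (thetaU_ne_zero _)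

/-- **`(F/Uⁿ)(γτ) = ((F ∣_{2n} γ)/Uⁿ)(τ)` for `γ ∈ Γ(2)`** — the automorphy factors cancel.
[folklore] -/
theorem thetaQuot_smul_of_mem_Gamma_two (n : ℕ) (F : ℍ → ℂ) {γ : SL(2, ℤ)}
    (hγ : γ ∈ CongruenceSubgroup.Gamma 2) (τ : ℍ) :
    thetaQuot n F (γ • τ) = thetaQuot n (F ∣[(2 * n : ℤ)] γ) τ := by
  rw [thetaQuot_apply, thetaQuot_apply, ModularForm.SL_slash_apply,
    thetaU_smul_of_mem_Gamma_two hγ, mul_pow]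
  have hd := denom_ne_zero (Matrix.SpecialLinearGroup.toGL
    ((Matrix.SpecialLinearGroup.map (Int.castRingHom ℝ)) γ)) τ
  have hU : thetaU τ ^ n ≠ 0 := pow_ne_zero _ (thetaU_ne_zero τ)
  set d := denom (Matrix.SpecialLinearGroup.toGL
    ((Matrix.SpecialLinearGroup.map (Int.castRingHom ℝ)) γ)) τ with hd'
  have hpow : d ^ (-(2 * n : ℤ)) = ((d ^ (2 : ℤ)) ^ n)⁻¹ := by
    rw [zpow_neg, zpow_mul, zpow_natCast]
  rw [hpow]
  have hd2 : (d ^ (2 : ℤ)) ^ n ≠ 0 := pow_ne_zero _ (zpow_ne_zero _ hd)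
  field_simp

/-- `F/Uⁿ → a` at `i∞` when `F → a` (`U → 1`). [folklore] -/
theorem tendsto_thetaQuot (n : ℕ) {F : ℍ → ℂ} {a : ℂ} (hF : Tendsto F atImInfty (𝓝 a)) :
    Tendsto (thetaQuot n F) atImInfty (𝓝 a) := by
  have hU : Tendsto (fun τ : ℍ ↦ thetaU τ ^ n) atImInfty (𝓝 1) := by
    simpa using tendsto_thetaU.pow n
  have := hF.div hU one_ne_zero
  rwa [div_one] at this

/-- `U` has period `2`. [folklore] -/
theorem thetaU_vadd_two (τ : ℍ) : thetaU ((2 : ℝ) +ᵥ τ) = thetaU τ := by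
  rw [show ((2 : ℝ) +ᵥ τ) = (1 : ℝ) +ᵥ ((1 : ℝ) +ᵥ τ) by rw [vadd_vadd]; norm_num,
    thetaU_vadd_one, thetaW_vadd_one]

/-- `U` has period `2N`. [folklore] -/
theorem thetaU_vadd_two_mul (N : ℕ) (τ : ℍ) : thetaU (((2 * N : ℕ) : ℝ) +ᵥ τ) = thetaU τ := by
  induction N with
  | zero => simp
  | succ N ih =>
    rw [show (((2 * (N + 1) : ℕ) : ℝ) +ᵥ τ) = (2 : ℝ) +ᵥ ((((2 * N : ℕ) : ℝ)) +ᵥ τ) by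
      rw [vadd_vadd]; push_cast; ring_nf, thetaU_vadd_two, ih]

/-- A function on `ℍ` invariant under `τ ↦ τ + h` is `h`-periodic in Mathlib's sense
(`Periodic (f ∘ ofComplex) h`). [folklore] -/
theorem periodic_comp_ofComplex_of_vadd {f : ℍ → ℂ} {h : ℝ} (hf : ∀ τ : ℍ, f (h +ᵥ τ) = f τ) :
    Function.Periodic (f ∘ ofComplex) h := by
  intro w
  by_cases hw : 0 < w.im
  · have hw' : 0 < (w + h).im := by simpa using hw
    simp only [Function.comp_apply, ofComplex_apply_of_im_pos hw, ofComplex_apply_of_im_pos hw']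
    rw [← hf ⟨w, hw⟩]
    congr 1
    apply UpperHalfPlane.ext
    simp [add_comm]
  · have hw0 : w.im ≤ 0 := not_lt.mp hw
    have hw' : (w + h).im ≤ 0 := by simpa using hw0
    simp only [Function.comp_apply, ofComplex_apply_eq_of_im_nonpos hw' hw0]

/-! ## Slashes `F ∣ h` of a modular form for a normal subgroup: period, limit at `i∞` -/

section Slash

variable {G : Subgroup SL(2, ℤ)} [G.FiniteIndex] {k : ℤ}

/-- The automorphy factor of `Tᵐ` is `1`. [folklore] -/
theorem denom_T_zpow (m : ℤ) (τ : ℍ) :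
    denom (Matrix.SpecialLinearGroup.toGL ((Matrix.SpecialLinearGroup.map (Int.castRingHom ℝ))
      (T ^ m))) τ = 1 := by
  have h := ModularGroup.denom_apply (T ^ m) τ
  have h10 : (T ^ m) 1 0 = 0 := by
    rw [show ((T ^ m) 1 0 : ℤ) = (T ^ m).1 1 0 from rfl, ModularGroup.coe_T_zpow]; simp
  have h11 : (T ^ m) 1 1 = 1 := by
    rw [show ((T ^ m) 1 1 : ℤ) = (T ^ m).1 1 1 from rfl, ModularGroup.coe_T_zpow]; simp
  rw [h10, h11] at h
  simpa using h

/-- The automorphy factor of `Tᵐ` is `1`. [folklore] -/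
theorem denom_T_pow (m : ℕ) (τ : ℍ) :
    denom (Matrix.SpecialLinearGroup.toGL ((Matrix.SpecialLinearGroup.map (Int.castRingHom ℝ))
      (T ^ m))) τ = 1 := by
  rw [← zpow_natCast]; exact denom_T_zpow m τ

/-- For `G ⊴ SL₂(ℤ)` of finite index with Wohlfahrt level `N_G` (`T^{N_G} ∈ G`) and any
`h ∈ SL₂(ℤ)`, the slash `F ∣ₖ h` of a modular form `F` for `G` is again `T^{N_G}`-invariant
(`h T^{N_G} h⁻¹ ∈ G`). [folklore] -/
theorem slash_slash_T_pow_wohlfahrtLevel [G.Normal] (F : ModularForm (G : Subgroup (GL (Fin 2) ℝ)) k)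
    (h : SL(2, ℤ)) :
    ((F : ℍ → ℂ) ∣[k] h) ∣[k] (T ^ wohlfahrtLevel G) = (F : ℍ → ℂ) ∣[k] h := by
  have hmem : h * T ^ wohlfahrtLevel G * h⁻¹ ∈ G :=
    Subgroup.Normal.conj_mem inferInstance _ (T_pow_wohlfahrtLevel_mem G) h
  have hinv : (F : ℍ → ℂ) ∣[k] (h * T ^ wohlfahrtLevel G * h⁻¹) = F := by
    rw [ModularForm.SL_slash]
    exact SlashInvariantFormClass.slash_action_eq F _ (Subgroup.mem_map_of_mem _ hmem)
  calc ((F : ℍ → ℂ) ∣[k] h) ∣[k] (T ^ wohlfahrtLevel G)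
      = (F : ℍ → ℂ) ∣[k] (h * T ^ wohlfahrtLevel G * h⁻¹ * h) := by
        rw [← SlashAction.slash_mul, inv_mul_cancel_right]
    _ = (F : ℍ → ℂ) ∣[k] h := by rw [SlashAction.slash_mul, hinv]

/-- `F ∣ₖ h` has period `N_G`. [folklore] -/
theorem slash_vadd_wohlfahrtLevel [G.Normal] (F : ModularForm (G : Subgroup (GL (Fin 2) ℝ)) k)
    (h : SL(2, ℤ)) (τ : ℍ) :
    ((F : ℍ → ℂ) ∣[k] h) (((wohlfahrtLevel G : ℕ) : ℝ) +ᵥ τ) = ((F : ℍ → ℂ) ∣[k] h) τ := by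
  have h1 := congrFun (slash_slash_T_pow_wohlfahrtLevel F h) τ
  rw [ModularForm.SL_slash_apply, denom_T_pow, one_zpow, mul_one] at h1
  rwa [← zpow_natCast, UpperHalfPlane.modular_T_zpow_smul, Int.cast_natCast] at h1

/-- **The value of `F ∣ₖ h` at `i∞` exists** (`F` a modular form for `G ⊴ SL₂(ℤ)` of finite
index, `h ∈ SL₂(ℤ)` arbitrary): `F ∣ₖ h → (its cusp function at 0)` along `Im τ → ∞`. [folklore] -/
theorem tendsto_slash_atImInfty [G.Normal] (F : ModularForm (G : Subgroup (GL (Fin 2) ℝ)) k)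
    (h : SL(2, ℤ)) :
    Tendsto ((F : ℍ → ℂ) ∣[k] h) atImInfty
      (𝓝 (cuspFunction (wohlfahrtLevel G : ℝ) ((F : ℍ → ℂ) ∣[k] h) 0)) := by
  set N : ℝ := (wohlfahrtLevel G : ℝ) with hN
  have hN0 : 0 < N := by rw [hN]; exact_mod_cast wohlfahrtLevel_pos G
  set f : ℍ → ℂ := (F : ℍ → ℂ) ∣[k] h with hf
  have hper : Function.Periodic (f ∘ ofComplex) N :=
    periodic_comp_ofComplex_of_vadd fun τ ↦ slash_vadd_wohlfahrtLevel F h τ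
  have hmd : MDiff f := by
    rw [hf, ModularForm.SL_slash]
    exact (F.holo').slash k _
  have hbd : IsBoundedAtImInfty f := ModularFormClass.bdd_at_infty_slash F h
  have hfan := analyticAt_cuspFunction_zero hN0 hper hmd hbd
  have heq : (cuspFunction N f ∘ fun τ : ℍ ↦ Function.Periodic.qParam N τ) = f := by
    funext τ
    exact eq_cuspFunction τ hN0.ne' hper
  exact (hfan.continuousAt.tendsto.comp (qParam_tendsto_atImInfty hN0)).congr fun τ ↦
    congrFun heq τ

end Slash

/-! ## `F/Uⁿ` for a modular form `F ∈ M_{2n}(G)`: invariance, cusp values, period -/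

section Form

variable {G : Subgroup SL(2, ℤ)} [G.FiniteIndex] {n : ℕ}

omit [G.FiniteIndex] in
/-- **`F/Uⁿ` is invariant under `G ∩ Γ(2)`** for `F ∈ M_{2n}(G)`. [folklore] -/
theorem thetaQuot_smul_of_mem (F : ModularForm (G : Subgroup (GL (Fin 2) ℝ)) (2 * n : ℤ))
    {γ : SL(2, ℤ)} (hγG : γ ∈ G) (hγ2 : γ ∈ CongruenceSubgroup.Gamma 2) (τ : ℍ) :
    thetaQuot n F (γ • τ) = thetaQuot n F τ := by
  have hmem : Matrix.SpecialLinearGroup.toGL ((Matrix.SpecialLinearGroup.map (Int.castRingHom ℝ)) γ) ∈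
      (G : Subgroup (GL (Fin 2) ℝ)) := Subgroup.mem_map_of_mem (Matrix.SpecialLinearGroup.mapGL ℝ) hγG
  rw [thetaQuot_smul_of_mem_Gamma_two n F hγ2]
  have hF : ((F : ℍ → ℂ) ∣[(2 * n : ℤ)] γ) = F := by
    rw [ModularForm.SL_slash]
    exact SlashInvariantFormClass.slash_action_eq F _ hmem
  rw [hF]

/-- **The values of `F/Uⁿ` at the cusps over `λ = 0`**: for `h ∈ Γ(2)`,
`(F/Uⁿ)(hτ) → c(h) := (F ∣_{2n} h)(i∞)` as `Im τ → ∞`. [folklore] -/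
theorem tendsto_thetaQuot_smul [G.Normal] (F : ModularForm (G : Subgroup (GL (Fin 2) ℝ)) (2 * n : ℤ))
    {h : SL(2, ℤ)} (hh : h ∈ CongruenceSubgroup.Gamma 2) :
    Tendsto (fun τ : ℍ ↦ thetaQuot n F (h • τ)) atImInfty
      (𝓝 (cuspFunction (wohlfahrtLevel G : ℝ) ((F : ℍ → ℂ) ∣[(2 * n : ℤ)] h) 0)) := by
  have heq : (fun τ : ℍ ↦ thetaQuot n F (h • τ)) = thetaQuot n ((F : ℍ → ℂ) ∣[(2 * n : ℤ)] h) := by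
    funext τ; exact thetaQuot_smul_of_mem_Gamma_two n F hh τ
  rw [heq]
  exact tendsto_thetaQuot n (tendsto_slash_atImInfty F h)

/-- `F/Uⁿ` has the limit `F(i∞)` at `i∞`. [folklore] -/
theorem tendsto_thetaQuot_form [G.Normal] (F : ModularForm (G : Subgroup (GL (Fin 2) ℝ)) (2 * n : ℤ)) :
    Tendsto (thetaQuot n F) atImInfty
      (𝓝 (cuspFunction (wohlfahrtLevel G : ℝ) (F : ℍ → ℂ) 0)) := by
  have := tendsto_thetaQuot_smul (n := n) F (one_mem _)
  simpa only [one_smul, SlashAction.slash_one] using this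

/-- **`F/Uⁿ` has period `2N_G`.** [folklore] -/
theorem thetaQuot_vadd [G.Normal] (F : ModularForm (G : Subgroup (GL (Fin 2) ℝ)) (2 * n : ℤ)) (τ : ℍ) :
    thetaQuot n F (((2 * wohlfahrtLevel G : ℕ) : ℝ) +ᵥ τ) = thetaQuot n F τ := by
  rw [thetaQuot_apply, thetaQuot_apply, thetaU_vadd_two_mul]
  congr 1
  have h1 := slash_vadd_wohlfahrtLevel F 1
  simp only [SlashAction.slash_one] at h1
  rw [show ((((2 * wohlfahrtLevel G : ℕ) : ℝ)) +ᵥ τ) =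
      ((wohlfahrtLevel G : ℕ) : ℝ) +ᵥ ((((wohlfahrtLevel G : ℕ) : ℝ)) +ᵥ τ) by
    rw [vadd_vadd]; push_cast; ring_nf, h1, h1]

/-- `F/Uⁿ ∘ ofComplex` is `2N_G`-periodic (Mathlib's hypothesis for `qExpansion (2N_G)`).
[folklore] -/
theorem periodic_thetaQuot [G.Normal] (F : ModularForm (G : Subgroup (GL (Fin 2) ℝ)) (2 * n : ℤ)) :
    Function.Periodic (thetaQuot n F ∘ ofComplex) ((2 * wohlfahrtLevel G : ℕ) : ℝ) :=
  periodic_comp_ofComplex_of_vadd (thetaQuot_vadd F)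

end Form

/-! ## `q`-expansions at period `2N_G`: `F/Uⁿ` has an integral expansion in `w = e^{πiτ/N_G}` -/

section Expansion

open PowerSeries Literature.NumberTheory.EllipticCurves.JacobiThetaNull

/-- **Changing the period multiplies the variable**: for `f` holomorphic, `h`-periodic and
bounded at `i∞`, `qExpansion (M h) f = (qExpansion h f)(X^M)` (`q_h = q_{Mh}^M`). [folklore] -/
theorem qExpansion_natMul_eq_expand {f : ℍ → ℂ} {h : ℝ} (hh : 0 < h)
    (hper : Function.Periodic (f ∘ ofComplex) h) (hmd : MDiff f) (hbd : IsBoundedAtImInfty f)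
    {M : ℕ} (hM : M ≠ 0) :
    qExpansion (M * h) f = PowerSeries.expand M hM (qExpansion h f) := by
  have hMpos : (0 : ℝ) < M := by exact_mod_cast Nat.pos_of_ne_zero hM
  have hMh : 0 < (M : ℝ) * h := mul_pos hMpos hh
  have hperM : Function.Periodic (f ∘ ofComplex) (((M : ℝ) * h : ℝ) : ℂ) := by
    have := hper.nat_mul M
    push_cast at this ⊢
    exact this
  have han : AnalyticAt ℂ (cuspFunction ((M : ℝ) * h) f) 0 :=
    analyticAt_cuspFunction_zero hMh hperM hmd hbd
  ext n
  refine qExpansion_coeff_eq_of_hasSum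
    (c := fun k ↦ coeff k (PowerSeries.expand M hM (qExpansion h f))) hMh han (fun τ ↦ ?_) n
  have hs := hasSum_qExpansion hh hper hmd hbd τ
  have hq : Function.Periodic.qParam h (τ : ℂ) = Function.Periodic.qParam ((M : ℝ) * h) τ ^ M := by
    simp only [Function.Periodic.qParam]
    rw [← Complex.exp_nat_mul]
    congr 1
    have hM' : (M : ℂ) ≠ 0 := by exact_mod_cast hM
    have hh' : (h : ℂ) ≠ 0 := by exact_mod_cast hh.ne'
    push_cast
    field_simp
  have hinj : Function.Injective fun m : ℕ ↦ M * m := mul_right_injective₀ hM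
  refine (hinj.hasSum_iff ?_).mp ?_
  · intro k hk
    rw [Set.mem_range, not_exists] at hk
    have hdvd : ¬ M ∣ k := fun ⟨m, hm⟩ ↦ hk m hm.symm
    simp only [PowerSeries.coeff_expand_of_not_dvd M hM _ hdvd, zero_smul]
  · convert hs using 1
    funext m
    simp only [Function.comp_apply, PowerSeries.coeff_expand_mul, hq, ← pow_mul]

/-- `U ∘ ofComplex` has period `2`. [folklore] -/
theorem periodic_thetaU : Function.Periodic (thetaU ∘ ofComplex) (2 : ℝ) :=
  periodic_comp_ofComplex_of_vadd thetaU_vadd_two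

/-- `U` is bounded at `i∞` (`U → 1`). [folklore] -/
theorem isBoundedAtImInfty_thetaU : IsBoundedAtImInfty thetaU := tendsto_thetaU.isBigO_one ℝ

/-- **`qExpansion 2 U = A⁴ ∈ 1 + Xℤ⟦X⟧`** (`A = qExpansion 2 θ₃ ∈ ℤ⟦X⟧`, tree
`ModularLambdaQExpansion`). [folklore] -/
theorem exists_qExpansion_two_thetaU_eq_map :
    ∃ Au : PowerSeries ℤ, constantCoeff Au = 1 ∧ qExpansion 2 thetaU = Au.map (Int.castRingHom ℂ) := by
  obtain ⟨A, hA0, -, hA⟩ := exists_qExpansion_theta3_eq_map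
  have hp : ∀ z : ℂ, 0 < z.im → theta3 (z + 2) = theta3 z := fun z _ ↦ by
    rw [show z + 2 = z + 1 + 1 by ring, theta3_add_one, theta4_add_one]
  have hpow := (qExpansion_two_pow hp (fun _ hz ↦ differentiableAt_theta3 hz) tendsto_theta3 4).1
  have hU : thetaU = (fun τ : ℍ ↦ theta3 τ) ^ 4 := by
    funext τ; rw [Pi.pow_apply, thetaU_apply]
  refine ⟨A ^ 4, by rw [map_pow, hA0, one_pow], ?_⟩
  rw [hU, hpow, hA, map_pow]

/-- **`qExpansion (2N) Uⁿ = (A⁴(X^N))ⁿ ∈ 1 + Xℤ⟦X⟧`.** [folklore] -/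
theorem exists_qExpansion_thetaU_pow_eq_map {N : ℕ} (hN : N ≠ 0) (n : ℕ) :
    ∃ E : PowerSeries ℤ, constantCoeff E = 1 ∧
      qExpansion ((2 * N : ℕ) : ℝ) (fun τ : ℍ ↦ thetaU τ ^ n) = E.map (Int.castRingHom ℂ) ∧
      AnalyticAt ℂ (cuspFunction ((2 * N : ℕ) : ℝ) fun τ : ℍ ↦ thetaU τ ^ n) 0 := by
  obtain ⟨Au, hAu0, hAu⟩ := exists_qExpansion_two_thetaU_eq_map
  have h2N : ((2 * N : ℕ) : ℝ) = (N : ℝ) * 2 := by push_cast; ring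
  have hexp : qExpansion ((2 * N : ℕ) : ℝ) thetaU =
      (PowerSeries.expand N hN Au).map (Int.castRingHom ℂ) := by
    rw [h2N, qExpansion_natMul_eq_expand two_pos periodic_thetaU mdifferentiable_thetaU
      isBoundedAtImInfty_thetaU hN, hAu, PowerSeries.map_expand]
  have hper : Function.Periodic (thetaU ∘ ofComplex) ((2 * N : ℕ) : ℝ) :=
    periodic_comp_ofComplex_of_vadd (thetaU_vadd_two_mul N)
  have h0 : (0 : ℝ) < ((2 * N : ℕ) : ℝ) := by
    have := Nat.pos_of_ne_zero hN; positivity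
  have han : AnalyticAt ℂ (cuspFunction ((2 * N : ℕ) : ℝ) thetaU) 0 :=
    analyticAt_cuspFunction_zero h0 hper mdifferentiable_thetaU isBoundedAtImInfty_thetaU
  obtain ⟨hpow, hcusp⟩ := qExpansion_pow han n
  have hfun : (thetaU ^ n : ℍ → ℂ) = fun τ : ℍ ↦ thetaU τ ^ n := by funext τ; rfl
  rw [hfun] at hpow hcusp
  refine ⟨PowerSeries.expand N hN Au ^ n, ?_, ?_, ?_⟩
  · rw [map_pow, PowerSeries.constantCoeff_expand, hAu0, one_pow]
  · rw [hpow, hexp, map_pow]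
  · rw [hcusp]; exact han.pow n

variable {G : Subgroup SL(2, ℤ)} [G.FiniteIndex] [G.Normal] {n : ℕ}

/-- A modular form for `G` is `N_G`-periodic (Mathlib form). [folklore] -/
theorem periodic_form {k : ℤ} (F : ModularForm (G : Subgroup (GL (Fin 2) ℝ)) k) :
    Function.Periodic ((F : ℍ → ℂ) ∘ ofComplex) (wohlfahrtLevel G : ℝ) := by
  refine periodic_comp_ofComplex_of_vadd fun τ ↦ ?_
  have h1 := slash_vadd_wohlfahrtLevel F 1 τ
  simpa only [SlashAction.slash_one] using h1

/-- **`qExpansion (2N_G) F = (qExpansion N_G F)(X²)`** for a modular form `F` for `G`.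
[folklore] -/
theorem qExpansion_form_two_mul {k : ℤ} (F : ModularForm (G : Subgroup (GL (Fin 2) ℝ)) k) :
    qExpansion ((2 * wohlfahrtLevel G : ℕ) : ℝ) F =
      PowerSeries.expand 2 two_ne_zero (qExpansion (wohlfahrtLevel G : ℝ) F) := by
  have h : ((2 * wohlfahrtLevel G : ℕ) : ℝ) = ((2 : ℕ) : ℝ) * (wohlfahrtLevel G : ℝ) := by push_cast; ring
  rw [h]
  exact qExpansion_natMul_eq_expand (by exact_mod_cast wohlfahrtLevel_pos G) (periodic_form F)
    F.holo' (ModularFormClass.bdd_at_infty F) two_ne_zero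

/-- The cusp function of `F/Uⁿ` at period `2N_G` is analytic at `0`. [folklore] -/
theorem analyticAt_cuspFunction_thetaQuot (F : ModularForm (G : Subgroup (GL (Fin 2) ℝ)) (2 * n : ℤ)) :
    AnalyticAt ℂ (cuspFunction ((2 * wohlfahrtLevel G : ℕ) : ℝ) (thetaQuot n F)) 0 := by
  have h0 : (0 : ℝ) < ((2 * wohlfahrtLevel G : ℕ) : ℝ) := by
    have := wohlfahrtLevel_pos G; positivity
  exact analyticAt_cuspFunction_zero h0 (periodic_thetaQuot F) (mdifferentiable_thetaQuot n F.holo')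
    ((tendsto_thetaQuot_form F).isBigO_one ℝ)

/-- `qExpansion (2N_G) (F/Uⁿ) · qExpansion (2N_G) (Uⁿ) = qExpansion (2N_G) F`. [folklore] -/
theorem qExpansion_thetaQuot_mul (F : ModularForm (G : Subgroup (GL (Fin 2) ℝ)) (2 * n : ℤ)) :
    qExpansion ((2 * wohlfahrtLevel G : ℕ) : ℝ) (thetaQuot n F) *
        qExpansion ((2 * wohlfahrtLevel G : ℕ) : ℝ) (fun τ : ℍ ↦ thetaU τ ^ n) =
      qExpansion ((2 * wohlfahrtLevel G : ℕ) : ℝ) F := by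
  obtain ⟨-, -, -, hanU⟩ := exists_qExpansion_thetaU_pow_eq_map (wohlfahrtLevel_pos G).ne' n
  rw [← qExpansion_mul (analyticAt_cuspFunction_thetaQuot F) hanU]
  congr 1
  funext τ
  rw [Pi.mul_apply, thetaQuot_apply, div_mul_cancel₀ _ (pow_ne_zero _ (thetaU_ne_zero τ))]

/-- **`F/Uⁿ` has an integral expansion in `w = e^{πiτ/N_G}`** when `F ∈ M_{2n}(G)` has integral
Fourier coefficients (`θ₃^{-4n} ∈ 1 + qℤ⟦q⟧`): there is `B ∈ ℤ⟦W⟧` with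
`qExpansion (2N_G) (F/Uⁿ) = B`. [cite: CalegariDimitrovTang2025, §3 proof of Proposition 15
("if furthermore `f(q) ∈ ℤ⟦q^{1/N}⟧`, then `x^* f ∈ ℤ[1/N]⟦x⟧`")] -/
theorem exists_qExpansion_thetaQuot_eq_map (F : ModularForm (G : Subgroup (GL (Fin 2) ℝ)) (2 * n : ℤ))
    (hint : ∀ m : ℕ, ∃ z : ℤ, coeff m (qExpansion (wohlfahrtLevel G : ℝ) F) = (z : ℂ)) :
    ∃ B : PowerSeries ℤ,
      qExpansion ((2 * wohlfahrtLevel G : ℕ) : ℝ) (thetaQuot n F) = B.map (Int.castRingHom ℂ) := by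
  choose a ha using hint
  have hF : qExpansion (wohlfahrtLevel G : ℝ) F = (PowerSeries.mk a).map (Int.castRingHom ℂ) := by
    ext m; rw [coeff_map, coeff_mk, ha m, eq_intCast]
  obtain ⟨E, hE0, hE, -⟩ := exists_qExpansion_thetaU_pow_eq_map (wohlfahrtLevel_pos G).ne' n
  have hEu : IsUnit E := by
    rw [PowerSeries.isUnit_iff_constantCoeff, hE0]; exact isUnit_one
  set Einv : PowerSeries ℤ := ↑(hEu.unit⁻¹) with hEinv
  have hEE : E * Einv = 1 := hEu.mul_val_inv
  refine ⟨PowerSeries.expand 2 two_ne_zero (PowerSeries.mk a) * Einv, ?_⟩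
  have hkey := qExpansion_thetaQuot_mul F
  rw [qExpansion_form_two_mul, hF, hE] at hkey
  -- cancel the unit `E`
  have hEu' : IsUnit (E.map (Int.castRingHom ℂ)) := hEu.map _
  refine (hEu'.mul_left_inj).mp ?_
  rw [hkey, map_mul, mul_assoc, ← map_mul, mul_comm Einv, hEE, map_one, mul_one,
    PowerSeries.map_expand]

end Expansion

end ModularLambda

end Literature.NumberTheory.Automorphic

end
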